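import Summits.HodgeConjecture.CorCM.Census.OcticTwistReduction
import Summits.HodgeConjecture.CorCM.Census.QuarticTwistResidual

/-!
# The octic twist `(ℤ/8 × B, (4,0))`, VII: THE CONSTANT-CONSTANT BLOCKS — an octic Hodge vector on the types `(cst u, cst u′)` is
# octic pairs plus constant-constant squares

COR-CM (cell `pub-hodgecm2`), count-neutral kernel combinatorics by the binder seat b09 (gen 33; lane COINVARIANT-TWIST / OCTIC RECON, design
step 3 (iv) of `HOME/pub-hodgecm2-b09/lean-g33/COINVARIANT-TWIST.md` PART C), on top of parts I–VI (`Census/OcticTwist*.lean`) and the quartic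
model (`Census/QuarticTwistModel.lean`: `cst`, `coef`, `hodge`, `pairVec`; `Census/QuarticTwistResidual.lean`: `chi`, `coef_cst`, `cst_eq_cst_iff`)
used BY NAME.  Theorems only (no definition, no `decide` beyond closed numerals of `ZMod 4`, no certificate, no named fact, no `sorry`).
HONEST FRAMING: `HC_CM` is NOT proved; nothing here is a period or a headline.

CONTENT.
* §1 **bi-marginal-zero vectors are second differences** (any `B`): if `marg₀ v = 0` and `marg₁ v = 0` then
  `v = Σ_T v(T) · (e_{T.1} − e_{s₀}) ⊗ (e_{T.2} − e_{t₀})` for any base types `s₀, t₀` (`eq_sum_tens_of_marg_eq_zero`) — the telescoping behind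
  seat b23ʼs `IndexTwoDescentMixed.span_mixed_eq`, in the pair model.
* §2 **quartic Hodge vectors on the constant types are `v(0)·(e_0 + e_2) + v(1)·(e_1 + e_3)`** (`eq_pairVec_of_cst`; the computation inside
  `QuarticTwistResidual.mem_pairs_of_cst`, exported).
* §3 **THE CONSTANT-CONSTANT THEOREM** (`cc_mem`, `B` non-empty): an octic Hodge vector supported on the constant-constant types lies in any
  submodule containing the octic pairs and the squares `(e_{cst a} − e_{cst 0}) ⊗ (e_{cst a′} − e_{cst 0})` — subtract
  `κ₀·pair(0,0) + (ρ₀−κ₀)·pair(0,1) + ρ₁·pair(1,1)` (`ρ = ` row masses, `κ = ` column masses; `ρ₀ + ρ₁ = κ₀ + κ₁`) to kill both marginals, then §1.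
  With part VI (`ccSquare₀_mem`: the squares come from the Weil lifts and the D-moves) this is the last block of the octic residual module.

## References
* [Pohlmann1968] H. Pohlmann, Algebraic cycles on abelian varieties of complex multiplication type, Ann. of Math. 88 (1968), Thm 1.
-/

namespace Summit.HodgeConjecture.CorCM.Census.OcticTwist

open Finset
open Summit.HodgeConjecture.CorCM.Census.QuarticTwist

variable (B : Type) [AddGroup B] [Fintype B] [DecidableEq B]

/-! ## §1 Bi-marginal-zero vectors are second differences -/

omit [AddGroup B] in
/-- **A vector with two vanishing marginals is the sum of its second differences against base types `s₀, t₀`.** [folklore] -/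
theorem eq_sum_tens_of_marg_eq_zero {v : Ty₂ B → ℤ} (h₀ : marg₀ B v = 0) (h₁ : marg₁ B v = 0) (s₀ t₀ : Ty B) :
    v = ∑ T : Ty₂ B, v T • tens B (Pi.single T.1 1 - Pi.single s₀ 1) (Pi.single T.2 1 - Pi.single t₀ 1) := by
  -- expand the second differences into four unit vectors
  have hexp : ∀ T : Ty₂ B, v T • tens B (Pi.single T.1 1 - Pi.single s₀ 1) (Pi.single T.2 1 - Pi.single t₀ 1) =
      v T • (Pi.single T 1 : Ty₂ B → ℤ) - v T • Pi.single (s₀, T.2) 1 - v T • Pi.single (T.1, t₀) 1 + v T • Pi.single (s₀, t₀) 1 := by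
    intro T
    rw [tens_sub_sub, single_eq_tens, single_eq_tens, single_eq_tens, single_eq_tens, smul_add, smul_sub, smul_sub]
  simp only [hexp, Finset.sum_add_distrib, Finset.sum_sub_distrib]
  -- (1) Σ v T • e_T = v
  have e1 : ∑ T : Ty₂ B, v T • (Pi.single T 1 : Ty₂ B → ℤ) = v := by
    conv_rhs => rw [← Finset.univ_sum_single v]
    refine Finset.sum_congr rfl fun T _ => ?_
    funext T'
    rw [Pi.smul_apply, Pi.single_apply, Pi.single_apply, smul_eq_mul]
    split_ifs <;> simp
  -- (2) Σ v T • e_(s₀, T.2) = Σ_t (marg₁ v t) • e_(s₀,t) = 0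
  have e2 : ∑ T : Ty₂ B, v T • (Pi.single (s₀, T.2) 1 : Ty₂ B → ℤ) = 0 := by
    rw [Fintype.sum_prod_type_right]
    refine Finset.sum_eq_zero fun t _ => ?_
    show ∑ s : Ty B, v (s, t) • (Pi.single (s₀, t) 1 : Ty₂ B → ℤ) = 0
    rw [← Finset.sum_smul]
    have : ∑ s : Ty B, v (s, t) = marg₁ B v t := rfl
    rw [this, h₁, Pi.zero_apply, zero_smul]
  -- (3) Σ v T • e_(T.1, t₀) = Σ_s (marg₀ v s) • e_(s,t₀) = 0
  have e3 : ∑ T : Ty₂ B, v T • (Pi.single (T.1, t₀) 1 : Ty₂ B → ℤ) = 0 := by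
    rw [Fintype.sum_prod_type]
    refine Finset.sum_eq_zero fun s _ => ?_
    show ∑ t : Ty B, v (s, t) • (Pi.single (s, t₀) 1 : Ty₂ B → ℤ) = 0
    rw [← Finset.sum_smul]
    have : ∑ t : Ty B, v (s, t) = marg₀ B v s := rfl
    rw [this, h₀, Pi.zero_apply, zero_smul]
  -- (4) (Σ v) • e_(s₀,t₀) = 0
  have e4 : ∑ T : Ty₂ B, v T • (Pi.single (s₀, t₀) 1 : Ty₂ B → ℤ) = 0 := by
    rw [← Finset.sum_smul, Fintype.sum_prod_type]
    have : ∑ s : Ty B, ∑ t : Ty B, v (s, t) = ∑ s : Ty B, marg₀ B v s := rfl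
    rw [this, h₀]
    simp
  rw [e1, e2, e3, e4, sub_zero, sub_zero, add_zero]

/-! ## §2 Quartic Hodge vectors on the constant types -/

omit [AddGroup B] in
/-- **A quartic Hodge vector supported on the constant types is `v(cst 0)·(e_0 + e_2) + v(cst 1)·(e_1 + e_3)`** (the forms at `(0,b₀)` and
`(1,b₀)` give `v(2) = v(0)`, `v(3) = v(1)`). [folklore] -/
theorem eq_pairVec_of_cst (b₀ : B) {v : Ty B → ℤ} (hv : v ∈ hodge B) (hsupp : ∀ s, v s ≠ 0 → ∃ u, s = cst B u) :
    v = v (cst B 0) • pairVec B (cst B 0) + v (cst B 1) • pairVec B (cst B 1) := by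
  classical
  have hinj : Set.InjOn (fun u : ZMod 4 => cst B u) ↑(univ : Finset (ZMod 4)) := fun u _ u' _ h => (cst_eq_cst_iff B b₀).mp h
  have hform : ∀ a : ZMod 4, ∑ u : ZMod 4, chi a u * v (cst B u) = 0 := by
    intro a
    have h := hv (a, b₀)
    unfold dotProduct at h
    rw [← Finset.sum_subset (subset_univ (univ.image fun u : ZMod 4 => cst B u)), Finset.sum_image hinj] at h
    · exact h
    · intro s _ hs
      have hz : v s = 0 := by
        by_contra hne
        obtain ⟨u, rfl⟩ := hsupp s hne
        exact hs (mem_image_of_mem _ (mem_univ u))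
      rw [hz, mul_zero]
  have hsum4 : ∀ g : ZMod 4 → ℤ, ∑ u : ZMod 4, g u = g 0 + g 1 + g 2 + g 3 := fun g => Fin.sum_univ_four g
  have h0 := hform 0
  have h1 := hform 1
  rw [hsum4] at h0 h1
  have c00 : chi 0 0 = 1 := by decide
  have c01 : chi 0 1 = -1 := by decide
  have c02 : chi 0 2 = -1 := by decide
  have c03 : chi 0 3 = 1 := by decide
  have c10 : chi 1 0 = 1 := by decide
  have c11 : chi 1 1 = 1 := by decide
  have c12 : chi 1 2 = -1 := by decide
  have c13 : chi 1 3 = -1 := by decide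
  rw [c00, c01, c02, c03] at h0
  rw [c10, c11, c12, c13] at h1
  have e02 : v (cst B 2) = v (cst B 0) := by linarith
  have e13 : v (cst B 3) = v (cst B 1) := by linarith
  have z4 : ((0 : ZMod 4) ≠ 1 ∧ (0 : ZMod 4) ≠ 2 ∧ (0 : ZMod 4) ≠ 3 ∧ (1 : ZMod 4) ≠ 0 ∧ (1 : ZMod 4) ≠ 2 ∧ (1 : ZMod 4) ≠ 3) ∧
      ((2 : ZMod 4) ≠ 0 ∧ (2 : ZMod 4) ≠ 1 ∧ (2 : ZMod 4) ≠ 3 ∧ (3 : ZMod 4) ≠ 0 ∧ (3 : ZMod 4) ≠ 1 ∧ (3 : ZMod 4) ≠ 2) := by decide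
  have key : ∀ u : ZMod 4, u = 0 ∨ u = 1 ∨ u = 2 ∨ u = 3 := by decide
  funext s
  unfold pairVec
  rw [cst_add_two, cst_add_two, show (0 : ZMod 4) + 2 = 2 by decide, show (1 : ZMod 4) + 2 = 3 by decide]
  simp only [Pi.add_apply, Pi.smul_apply, Pi.single_apply, smul_eq_mul]
  by_cases hc : ∃ u, s = cst B u
  · obtain ⟨u, rfl⟩ := hc
    simp only [cst_eq_cst_iff B b₀]
    rcases key u with rfl | rfl | rfl | rfl <;> simp [z4, e02, e13]
  · have hs : v s = 0 := by
      by_contra h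
      exact hc (hsupp s h)
    have hne : ∀ u : ZMod 4, s ≠ cst B u := fun u h => hc ⟨u, h⟩
    simp [hs, hne]

omit [AddGroup B] in
/-- The mass of a quartic pair is `2`. [folklore] -/
theorem sum_pairVec (s : Ty B) : ∑ x, pairVec B s x = 2 := by
  unfold pairVec
  simp only [Pi.add_apply, sum_add_distrib, Finset.sum_pi_single', mem_univ, if_true]
  rfl

/-! ## §3 The constant-constant theorem -/

omit [AddGroup B] in
/-- The first marginal of a vector supported on constant-constant types is supported on constant types. [folklore] -/
theorem marg₀_supp_cst {r : Ty₂ B → ℤ} (hsupp : ∀ T, r T ≠ 0 → ∃ u u' : ZMod 4, T = (cst B u, cst B u')) (s : Ty B)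
    (hs : marg₀ B r s ≠ 0) : ∃ u, s = cst B u := by
  rw [marg₀_apply] at hs
  obtain ⟨t, _, ht⟩ := Finset.exists_ne_zero_of_sum_ne_zero hs
  obtain ⟨u, u', hT⟩ := hsupp (s, t) ht
  exact ⟨u, (Prod.ext_iff.mp hT).1⟩

omit [AddGroup B] in
/-- The second marginal of a vector supported on constant-constant types is supported on constant types. [folklore] -/
theorem marg₁_supp_cst {r : Ty₂ B → ℤ} (hsupp : ∀ T, r T ≠ 0 → ∃ u u' : ZMod 4, T = (cst B u, cst B u')) (t : Ty B)
    (ht : marg₁ B r t ≠ 0) : ∃ u, t = cst B u := by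
  rw [marg₁_apply] at ht
  obtain ⟨s, _, hs⟩ := Finset.exists_ne_zero_of_sum_ne_zero ht
  obtain ⟨u, u', hT⟩ := hsupp (s, t) hs
  exact ⟨u', (Prod.ext_iff.mp hT).2⟩

omit [AddGroup B] in
/-- The total mass is the mass of either marginal. [folklore] -/
theorem sum_marg₀_eq_sum_marg₁ (r : Ty₂ B → ℤ) : ∑ s, marg₀ B r s = ∑ t, marg₁ B r t := by
  simp only [marg₀_apply, marg₁_apply]
  rw [← Fintype.sum_prod_type, ← Fintype.sum_prod_type_right]

omit [AddGroup B] in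
/-- **THE CONSTANT-CONSTANT THEOREM.**  An octic Hodge vector supported on the constant-constant types lies in every submodule containing
the octic pairs and the squares `(e_{cst a} − e_{cst 0}) ⊗ (e_{cst a′} − e_{cst 0})`. [folklore] -/
theorem cc_mem [Nonempty B] {N₂ : Submodule ℤ (Ty₂ B → ℤ)} (hP : pairs₂ B ≤ N₂)
    (hQ : ∀ a a' : ZMod 4, tens B (Pi.single (cst B a) 1 - Pi.single (cst B 0) 1) (Pi.single (cst B a') 1 - Pi.single (cst B 0) 1) ∈ N₂)
    {r : Ty₂ B → ℤ} (hr : r ∈ hodge₂ B) (hsupp : ∀ T, r T ≠ 0 → ∃ u u' : ZMod 4, T = (cst B u, cst B u')) : r ∈ N₂ := by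
  obtain ⟨b₀⟩ := ‹Nonempty B›
  rw [mem_hodge₂_iff] at hr
  -- the two marginals are pairs of constants
  have hm₀ := eq_pairVec_of_cst B b₀ hr.1 (marg₀_supp_cst B hsupp)
  have hm₁ := eq_pairVec_of_cst B b₀ hr.2 (marg₁_supp_cst B hsupp)
  have hsum := sum_marg₀_eq_sum_marg₁ B r
  obtain ⟨ρ₀, hρ₀⟩ : ∃ x, marg₀ B r (cst B 0) = x := ⟨_, rfl⟩
  obtain ⟨ρ₁, hρ₁⟩ : ∃ x, marg₀ B r (cst B 1) = x := ⟨_, rfl⟩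
  obtain ⟨κ₀, hκ₀⟩ : ∃ x, marg₁ B r (cst B 0) = x := ⟨_, rfl⟩
  obtain ⟨κ₁, hκ₁⟩ : ∃ x, marg₁ B r (cst B 1) = x := ⟨_, rfl⟩
  rw [hρ₀, hρ₁] at hm₀
  rw [hκ₀, hκ₁] at hm₁
  -- the masses agree: ρ₀ + ρ₁ = κ₀ + κ₁
  have hmass : ρ₀ + ρ₁ = κ₀ + κ₁ := by
    rw [hm₀, hm₁] at hsum
    simp only [Pi.add_apply, Pi.smul_apply, smul_eq_mul, Finset.sum_add_distrib, ← Finset.mul_sum, sum_pairVec] at hsum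
    omega
  -- the pairs with the same marginals
  let P : Ty₂ B → ℤ := κ₀ • pairVec₂ B (cst B 0, cst B 0) + (ρ₀ - κ₀) • pairVec₂ B (cst B 0, cst B 1) + ρ₁ • pairVec₂ B (cst B 1, cst B 1)
  have hPN : P ∈ N₂ :=
    Submodule.add_mem _ (Submodule.add_mem _ (Submodule.smul_mem _ _ (hP (pairVec₂_mem_pairs₂ B _)))
      (Submodule.smul_mem _ _ (hP (pairVec₂_mem_pairs₂ B _)))) (Submodule.smul_mem _ _ (hP (pairVec₂_mem_pairs₂ B _)))
  have hP₀ : marg₀ B P = marg₀ B r := by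
    show marg₀ B (_ + _ + _) = _
    rw [map_add, map_add, map_smul, map_smul, map_smul, marg₀_pairVec₂, marg₀_pairVec₂, marg₀_pairVec₂, hm₀]
    show κ₀ • pairVec B (cst B 0) + (ρ₀ - κ₀) • pairVec B (cst B 0) + ρ₁ • pairVec B (cst B 1) =
      ρ₀ • pairVec B (cst B 0) + ρ₁ • pairVec B (cst B 1)
    module
  have hP₁ : marg₁ B P = marg₁ B r := by
    show marg₁ B (_ + _ + _) = _
    rw [map_add, map_add, map_smul, map_smul, map_smul, marg₁_pairVec₂, marg₁_pairVec₂, marg₁_pairVec₂, hm₁]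
    show κ₀ • pairVec B (cst B 0) + (ρ₀ - κ₀) • pairVec B (cst B 1) + ρ₁ • pairVec B (cst B 1) =
      κ₀ • pairVec B (cst B 0) + κ₁ • pairVec B (cst B 1)
    have e : ρ₁ = κ₀ + κ₁ - ρ₀ := by omega
    rw [e]
    module
  -- `r − P` has two vanishing marginals and constant-constant support
  have hz₀ : marg₀ B (r - P) = 0 := by rw [map_sub, hP₀, sub_self]
  have hz₁ : marg₁ B (r - P) = 0 := by rw [map_sub, hP₁, sub_self]
  have hPsupp : ∀ T, P T ≠ 0 → ∃ u u' : ZMod 4, T = (cst B u, cst B u') := by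
    intro T hT
    by_contra hnot
    apply hT
    have hne : ∀ u u' : ZMod 4, T ≠ (cst B u, cst B u') := fun u u' h => hnot ⟨u, u', h⟩
    show κ₀ • pairVec₂ B (cst B 0, cst B 0) T + (ρ₀ - κ₀) • pairVec₂ B (cst B 0, cst B 1) T + ρ₁ • pairVec₂ B (cst B 1, cst B 1) T = 0
    unfold pairVec₂
    simp only [cst_add_two, Pi.add_apply, Pi.single_apply, smul_eq_mul, if_neg (hne _ _)]
    ring
  have hsupp' : ∀ T, (r - P) T ≠ 0 → ∃ u u' : ZMod 4, T = (cst B u, cst B u') := by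
    intro T hT
    rw [Pi.sub_apply] at hT
    by_cases h : r T = 0
    · rw [h, zero_sub, neg_ne_zero] at hT
      exact hPsupp T hT
    · exact hsupp T h
  -- second differences of constants
  have hdec := eq_sum_tens_of_marg_eq_zero B hz₀ hz₁ (cst B 0) (cst B 0)
  have hmem : r - P ∈ N₂ := by
    rw [hdec]
    refine Submodule.sum_mem _ fun T _ => ?_
    by_cases hT : (r - P) T = 0
    · rw [hT, zero_smul]
      exact Submodule.zero_mem _
    · obtain ⟨u, u', rfl⟩ := hsupp' T hT
      exact Submodule.smul_mem _ _ (hQ u u')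
  have e : r = P + (r - P) := by abel
  rw [e]
  exact Submodule.add_mem _ hPN hmem

end Summit.HodgeConjecture.CorCM.Census.OcticTwist
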